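import Summits.QuantumFields.YangMills.Theorems.BalabanUVNodesN21KeyedShellWeightShellZero
import Summits.QuantumFields.YangMills.Theorems.BalabanUVNodesSpineReadingOfRecord13CoPHV

/-!
# BalabanUVNodes ∕ N20 (NE7b) — the `hedge`-JOINT COMPANION, module 13: THE SHELL DIAL LINEARISES THE CORE —
# with the shell split FREE (as in K3⁷ v5's `∃ sh : ShellSplit₁₃CoPH 2 0`) the N19′ core edge holds OUTRIGHT at radius `δ ≡ 0` for the ℓ¹-OPTIMAL shells,
# and the joint content of (N19′ core ∧ N21 shell weight) on the good classes IS «ℓ¹ CLASS-MATCHING MODULO CONSTANTS» — located answer to CRIT-1's point (2)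
# on the crux card `window-key-core` («the SHELL DIAL `sh` not closed»)

Cell `pub-ymgap` (HUMAN RULING D-0062 Track A; D-0149 width push), seat `pub-ymgap-dag-n20-w3` (WIDTH SEAT 3 of 3 on NODE n20 = NE7b) gen 5, CLAIM-2 ∕ INTENT-2
(pub-ymgap INBOX).  Filed `--kind proof --supports stmt-QuantumFields-20544 --as helper` (K3⁷ `SpineGivenEndpointR13SepCoPH`; skeleton of record v5 941dddb108cbaacf, texts
mirrored BY NAME in dag-n27-w1's `Thm/BalabanUVNodesK3V5Defs`); COUNT-NEUTRAL.  [III] = [Balaban1988Convergent], [LF-I∕II] = [Balaban1989LargeFieldI∕II], [King1986] = CMP 102.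

WHY.  Stub 2 of K3⁷ v5 reads `∃ (jc : CutReading) (sh : ShellSplit₁₃CoPH 2 0) (cr : SpineReading), PinnedAtLive jc sh cr ∧ KeyedRelWeight cr ∧ KeyedShellWeight cr ∧
KeyedExtraction cr ∧ KeyedCoreEdgeHolderD4 β cr rr`, and dag-n20-d's `ShellSplit₁₃CoPH N K₀` (`Thm/BalabanUVNodesSpineReadingOfRecord13CoPH` :154) is the TYPE of an ARBITRARY pair
`(shA, shB)` of functions on the σ-packed keys per tuple — the shell split is the PROVER's DIAL (plan g80∕g81 rulings (a); dag-n20-w2 LOCATED-2∕3 priced its ZERO end: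
«at `(jc, sh) = (0, 0)` … `KeyedCoreEdgeHolderD4 β (crOfRecord₁₃ 0 0) rr` = the EXACT NE7 core edge on EVERY keyed class with NO shell allowance — the irreducible content»).
The tree's N21 shape `T4IndicatorShell.ShellWeightBound l₀ T A B shA shB Wsh` asks of the shells ONLY `0 ≤ sh ≤ term` pointwise and a summable TOTAL relative weight `Wsh` per run;
the N19′ shape `Spine.NE7.Core` tests `e^{c ∓ vol·δ}(A − shA)` against `B − shB` on the good classes.  THIS FILE records what the OTHER end of the shell dial does (CRIT-1 g4's
triage of `window-key-core`, point (2): «the SHELL DIAL `sh : ShellSplit₁₃CoPH 2 0` not closed (the caricature `caricature_not_coreEdge` has no shells)», INBOX l.28908):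
* THE ℓ¹-OPTIMAL SHELLS.  For any constants `c : ℕ → ℝ` put `shA⋆ := (A − e^{−c}B)⁺`, `shB⋆ := (B − e^{c}A)⁺` (pointwise `max 0`).  Then `0 ≤ shA⋆ ≤ A`, `0 ≤ shB⋆ ≤ B`
  (weights non-negative) and `B − shB⋆ = e^{c}·(A − shA⋆)` IDENTICALLY (§1 `sub_posPart_eq_exp_mul_sub_posPart`, no sign hypothesis) — so `NE7.Core … (A − shA⋆) (B − shB⋆) δ`
  holds for EVERY `δ` with `0 ≤ vol·δ K`, in particular `δ ≡ 0`, for EVERY bad class, EVERY `c` (§1 ★★ `core_optShell`): the N19′ conjunct is FREE at this end of the dial, and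
  ALL two-run content sits in N21's `Summable Wsh` for these shells, whose cost is EXACTLY the one-sided ℓ¹ class mismatch `Σ_T (A − e^{−c}B)⁺`, `Σ_T (B − e^{c}A)⁺`
  (§1 ★★ `shellWeightBound_optShell`: `ShellWeightBound` from the two mismatch FRACTIONS `≤ w K`, `w ≥ 0` summable).
* THE CONVERSE IS IN THE TREE (dag-n20-w5 g0 `Thm/BalabanUVNodesN20QuantisedRatioNoRescue` p606977 ✓ §1, BY NAME — not re-typed here): for ANY shells with `0 ≤ sh` the
  sandwich forces `(B − e^{c+r}A)⁺ ≤ shB`, `(e^{c−r}A − B)⁺ ≤ e^{c−r}·shA` on every good class (`posPart_upper_le_shell` ∕ `posPart_lower_le_shell`) and the binders pay the total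
  two-sided misfit, `Σ_T misfit(c, r) ≤ (W_K + Wsh_K)·(Σ_T B + e^{c−r}Σ_T A)` (`sum_misfit_le_of_faces`); dag-n20-w4 g0's INTENT-1 `…N20HybridClassLawBudget` states the same budget
  for the class LAWS.  Together with §1 here: up to the radius slack, **(N19′ ∧ N21) with a free shell dial ≡ «the class-weight vectors of the two runs match in ℓ¹ modulo one
  constant per `K`, with a summable mismatch fraction»** — strictly between node U5's DECL target (TOTAL matching `MatchingModConstants`, which it implies: §1 ★
  `hybridNE7_optShell_of_l1Mismatch` ∘ `NE7.target_of_hybridNE7`) and the termwise sup-form `Core` at zero shells.  THIS FILE is the SUFFICIENCY ∕ «dial used» half; theirs the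
  NECESSITY ∕ «no dial rescues under (Q) ∧ (ACn)» half.
* AT THE RECORD (§2, dag-n20-d's transfers `core_crOfRecord₁₃VAt` ∕ `shellWeightBound_crOfRecord₁₃VAt` ∕ `relWeightBound_crOfRecord₁₃VAt` BY NAME, weights `≥ 0` by dag-n20-w2's
  `weightA₁₃_nonneg ∕ weightB₁₃_nonneg` p593923): at `crOfRecord₁₃VAt K₀ jcut sh⋆` — EVERY offset, EVERY cut policy, EVERY tuple with core provisos, EVERY `g₀ ∕ os` — the N19′
  pair `Core … (cr).δ ∧ Summable (cr).δ` holds OUTRIGHT (★★★ `core_crOfRecord₁₃VAt_optShell`), and N21's face there follows from the summable ℓ¹ mismatch fractions of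
  `weightA₁₃ ∕ weightB₁₃` (★★ `shellWeightBound_crOfRecord₁₃VAt_optShell_of_l1Mismatch`).
* IN K3⁷ v5's NAMES (COMPANION module 13b `Thm/BalabanUVNodesN20CoreEdgeShellDialStubText`, `K3V5Defs` BY NAME — kept out of this file so that it stays outside the route's import cone): for EVERY `β`, EVERY rate reading `rr`, EVERY cut reading `jc` and EVERY constant reading `cK`, with `sh⋆` the ℓ¹-optimal split and
  `cr⋆ := fun F θ hP g₀ os ↦ crOfRecord₁₃V (jc F θ hP g₀ os) sh⋆ F θ hP g₀ os` (pinned EVERYWHERE): ★★★ `keyedCoreEdgeHolderD4_crOfRecord₁₃V_optShell` — `KeyedCoreEdgeHolderD4 β cr⋆ rr`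
  HOLDS, the rates hypothesis `PHolderD4` UNREAD; `pinnedAtLive_crOfRecord₁₃V` (rfl); at `jc := 0` also `KeyedRelWeight cr⋆` (dag-n20-w2 p590852 BY NAME) — ★★ `pinned_relWeight_coreEdge_optShell`:
  THREE of stub 2's five conjuncts from NO estimate; and ★★ `keyedShellWeight_crOfRecord₁₃V_optShell_of_l1Mismatch` — the fourth, `KeyedShellWeight cr⋆`, from ONE summability letter
  per guarded admissible tuple: «the one-sided ℓ¹ mismatch fractions of `(weightB₁₃, e^{c_K} weightA₁₃)` over the class set are `≤ w K`, `w` summable» (stated inline there, no def).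
LOCATED CONSEQUENCE (for plan g82 ∕ the n19 ∕ n21 lanes ∕ cdisprove; nothing proposed here): under v5's free `∃ sh`, the split of stub 2's two-run content into N19′ (`KeyedCoreEdgeHolderD4`)
and N21 (`KeyedShellWeight`) is DEGENERATE at BOTH ends of the shell dial — at `sh = 0` N21 is free and N19′ carries everything (dag-n20-w2 LOCATED-3), at `sh = sh⋆` N19′ is free and
N21 carries everything — and the INVARIANT content of the pair is the summable ℓ¹ class-matching modulo constants of `(weightA₁₃, weightB₁₃)` at the pinned key (plus N27x on the live
line, dag-n20-d's theorem, and the off-live reading, dag-n20-w1 p598780 ∕ dag-n27-c).  CRIT-1 (2) thus reads: the card's kill (N) survives the shell dial iff the MASS of the classes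
mismatched beyond any one constant is not summable — a statement about the weight DISTRIBUTION over old-large-field counts (concentration), not about two extreme classes; and the
intended reading of `sh` as Bałaban's INDICATOR shells at lowered thresholds ([LF-I] p.193; dag-n21-d's `shellSplitOfRecord₁₃At N K₀ ρA ρB`, this lineage's modules 7–11) is a
RESTRICTION OF THE DIAL the registered text does not impose — a pin `sh := shellSplitOfRecord₁₃At …` (like (t-JC)∕(t-V)) would restore the N19′∕N21 division of labour.  Said, not decided.

HONEST FRAMING.  [folklore] `max`∕`exp` arithmetic and finite-sum bookkeeping over the tree's SHAPES (`NE7.Core`, `ShellWeightBound`, `RelWeightBound`, `HybridNE7`) and dag-n20-d's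
reading of record BY NAME; count-neutral; proves NO estimate of the programme: the ℓ¹ mismatch letter of §3 is a HYPOTHESIS (inhabited for no Bałaban family today — A2 declared; as a
statement it is the two-run UV-stability content of NE7∕NE7b∕NE7c at the pinned key, NOT PRINTED for `d = 4`, NOT proved); §2's (and the companion's) hypothesis-free theorems book NOTHING about Bałaban's
objects beyond `0 ≤` class weights (they say where the registered text puts its content, not that the content holds).  NE7 ∕ NE7b ∕ NE7c NOT PRINTED ∕ NOT PROVED; N19 ∕ N20 ∕ N21 NOT
discharged; K3⁷ NOT closed; counts unmoved (typed 28∕28 · discharged 5∕27); no count claim.  One finite `𝕋⁴_{L^K}` programme at fixed `ε = L^{−K}`, Bałaban AS PRINTED; the YM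
mass gap (Clay) is NOT proved by any of this — R4 closes the conditional finite-𝕋⁴ rung `BalabanLadder.UV` only; NOT ℝ⁴, NOT continuum, NOT OS.  No `def`, no `instance`, no
`notation`, no `sorry`, no private decls (the optimal shells are spelled as lambdas; their existence as a `ShellSplit₁₃CoPH` is the ∃-theorem `exists_optShellSplit`).  Sources
(location only): [King1986] (3.10)–(3.13) pp.656–657 (hybrid template); [LF-I] (0.2)–(0.4) p.176, p.193 (indicator shells); [LF-II] Thm 1 + (0.1) pp.355–356; [III] (2.18) p.257.
-/

noncomputable section

open Finset
open scoped BigOperators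

namespace Summit.QuantumFields.YangMills.BalabanUVNodes.N20CoreEdgeShellDial

open Literature.MathematicalPhysics.QuantumFieldTheory.Balaban1983to89
open Literature.MathematicalPhysics.QuantumFieldTheory.Balaban1983to89.T4Continuum
open Literature.MathematicalPhysics.QuantumFieldTheory.Balaban1983to89.Node00
open T4WeightBudget (RelWeightBound)
open T4IndicatorShell (ShellWeightBound)
open T4MatchingAssembly (HybridNE7)
open T4HybridMatching (hybridDelta)
open T4ContinuumYM4Torus (ForSmallCouplings)
open Summit.QuantumFields.BalabanUV.T4Continuum.Spine
open YMDAG.UVSplit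
open Summit.QuantumFields.YangMills.BalabanUVNodes.N21KeyedShellWeightShellZero (weightA₁₃_nonneg weightB₁₃_nonneg)
open Summit.QuantumFields.YangMills.BalabanUVNodes.N20KeyedRelWeightCutZero (relWeightBound_carriers₁₃_cutZero)

/-! ## §1 Abstract: the ℓ¹-optimal shells, `Core` at radius zero, the shell cost (the converse is dag-n20-w5's p606977 §1, BY NAME) -/

section Abstract

variable {ι : Type*} [DecidableEq ι] {l₀ vol : ℝ} {T : ℕ → Finset ι} {Bad : ℕ → ℝ → Finset ι}

/-- **THE MATCHING IDENTITY OF THE ℓ¹-OPTIMAL SHELLS** (no sign hypothesis): `b − (b − e^{c}a)⁺ = e^{c}·(a − (a − e^{−c}b)⁺)` — both sides equal `min (b, e^{c}a)`. [folklore] -/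
theorem sub_posPart_eq_exp_mul_sub_posPart (a b c : ℝ) :
    b - max 0 (b - Real.exp c * a) = Real.exp c * (a - max 0 (a - Real.exp (-c) * b)) := by
  have hee : Real.exp c * Real.exp (-c) = 1 := by rw [← Real.exp_add, add_neg_cancel, Real.exp_zero]
  have hinv : Real.exp (-c) * (Real.exp c * a) = a := by
    rw [← mul_assoc, ← Real.exp_add, neg_add_cancel, Real.exp_zero, one_mul]
  rcases le_or_gt b (Real.exp c * a) with h | h
  · have h2 : 0 ≤ a - Real.exp (-c) * b := by
      have h3 : Real.exp (-c) * b ≤ Real.exp (-c) * (Real.exp c * a) := mul_le_mul_of_nonneg_left h (Real.exp_pos _).le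
      rw [hinv] at h3
      linarith
    rw [max_eq_left (sub_nonpos.mpr h), max_eq_right h2, sub_zero, sub_sub_cancel, ← mul_assoc, hee, one_mul]
  · have h2 : a - Real.exp (-c) * b ≤ 0 := by
      have h3 : Real.exp (-c) * (Real.exp c * a) ≤ Real.exp (-c) * b := mul_le_mul_of_nonneg_left h.le (Real.exp_pos _).le
      rw [hinv] at h3
      linarith
    rw [max_eq_right (sub_nonneg.mpr h.le), max_eq_left h2, sub_zero, sub_sub_cancel]

/-- The ℓ¹-optimal shell of a non-negative weight against a non-negative partner lies between `0` and the weight: `0 ≤ (a − e^{c'}b)⁺ ≤ a`. [folklore] -/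
theorem posPart_sub_exp_mul_le {a b : ℝ} (c' : ℝ) (ha : 0 ≤ a) (hb : 0 ≤ b) : max 0 (a - Real.exp c' * b) ≤ a :=
  max_le ha (sub_le_self _ (mul_nonneg (Real.exp_pos _).le hb))

/-- **`Core` FROM AN EXACT RATIO**: if on every good class run B's core IS `e^{c_K}` times run A's (non-negative) core, `NE7.Core` holds for EVERY radius `δ` with `0 ≤ vol·δ K`
— the sandwich is an equality.  (General cores, any bad class; dag-n20-w5's `core_of_classConstant_ratio` is the zero-shell ∕ empty-bad ∕ zero-radius instance on the full
terms.) [folklore] -/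
theorem core_of_exact_ratio {P Q : ℕ → ℝ → ι → ℝ} {δ : ℕ → ℝ} (c : ℕ → ℝ)
    (hP : ∀ (K : ℕ) (t : ℝ), |t| ≤ l₀ → ∀ τ ∈ T K \ Bad K t, 0 ≤ P K t τ)
    (hPQ : ∀ (K : ℕ) (t : ℝ), |t| ≤ l₀ → ∀ τ ∈ T K \ Bad K t, Q K t τ = Real.exp (c K) * P K t τ)
    (hδ : ∀ K, 0 ≤ vol * δ K) :
    NE7.Core l₀ vol T Bad P Q δ := by
  intro K
  refine ⟨c K, fun t ht τ hτ => ?_⟩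
  have hp := hP K t ht τ hτ
  rw [hPQ K t ht τ hτ]
  exact ⟨mul_le_mul_of_nonneg_right (Real.exp_le_exp.mpr (by linarith [hδ K])) hp,
    mul_le_mul_of_nonneg_right (Real.exp_le_exp.mpr (by linarith [hδ K])) hp⟩

/-- **★★ `Core` AT THE ℓ¹-OPTIMAL SHELLS, ANY CONSTANTS, ANY RADIUS `≥ 0`, ANY BAD CLASS.**  With `shA⋆ := (A − e^{−c}B)⁺`, `shB⋆ := (B − e^{c}A)⁺` on non-negative weights the
shell-free cores satisfy `B − shB⋆ = e^{c}(A − shA⋆)` identically, so `NE7.Core l₀ vol T Bad (A − shA⋆) (B − shB⋆) δ` for every `δ` with `0 ≤ vol·δ K` — the N19′ conjunct is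
FREE at this end of the shell dial. [cite: King1986, (3.10)–(3.13) pp.656–657 (hybrid template only)] [folklore] -/
theorem core_optShell (A B : ℕ → ℝ → ι → ℝ) (c : ℕ → ℝ) {δ : ℕ → ℝ}
    (hA : ∀ (K : ℕ) (t : ℝ), |t| ≤ l₀ → ∀ τ ∈ T K \ Bad K t, 0 ≤ A K t τ)
    (hB : ∀ (K : ℕ) (t : ℝ), |t| ≤ l₀ → ∀ τ ∈ T K \ Bad K t, 0 ≤ B K t τ)
    (hδ : ∀ K, 0 ≤ vol * δ K) :
    NE7.Core l₀ vol T Bad (fun K t τ => A K t τ - max 0 (A K t τ - Real.exp (-c K) * B K t τ))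
      (fun K t τ => B K t τ - max 0 (B K t τ - Real.exp (c K) * A K t τ)) δ :=
  core_of_exact_ratio c
    (fun K t ht τ hτ => sub_nonneg.mpr (posPart_sub_exp_mul_le (-c K) (hA K t ht τ hτ) (hB K t ht τ hτ)))
    (fun K t _ τ _ => sub_posPart_eq_exp_mul_sub_posPart (A K t τ) (B K t τ) (c K)) hδ

/-- The radius-zero case: `NE7.Core … (A − shA⋆) (B − shB⋆) 0`. [folklore] -/
theorem core_optShell_zero (A B : ℕ → ℝ → ι → ℝ) (c : ℕ → ℝ)
    (hA : ∀ (K : ℕ) (t : ℝ), |t| ≤ l₀ → ∀ τ ∈ T K \ Bad K t, 0 ≤ A K t τ)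
    (hB : ∀ (K : ℕ) (t : ℝ), |t| ≤ l₀ → ∀ τ ∈ T K \ Bad K t, 0 ≤ B K t τ) :
    NE7.Core l₀ vol T Bad (fun K t τ => A K t τ - max 0 (A K t τ - Real.exp (-c K) * B K t τ))
      (fun K t τ => B K t τ - max 0 (B K t τ - Real.exp (c K) * A K t τ)) (fun _ => 0) :=
  core_optShell A B c hA hB fun K => by simp

omit [DecidableEq ι] in
/-- **★★ THE SHELL COST OF THE ℓ¹-OPTIMAL SHELLS = THE ONE-SIDED ℓ¹ CLASS MISMATCH.**  On non-negative weights the optimal shells satisfy `0 ≤ sh⋆ ≤ term` pointwise; if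
at every `K` and `|t| ≤ l₀` the mismatch sums `Σ_T (A − e^{−c}B)⁺ ≤ w K · Σ_T A` and `Σ_T (B − e^{c}A)⁺ ≤ w K · Σ_T B` with `0 ≤ w` summable, then
`ShellWeightBound l₀ T A B shA⋆ shB⋆ w` — N21's shape is MET by the mismatch fractions.  (Its content at the record is the two-run matching itself — NOT PRINTED, NOT proved.)
[cite: Balaban1989LargeFieldI, p.193 (the printed shells are indicator shells — template only)] [folklore] -/
theorem shellWeightBound_optShell (A B : ℕ → ℝ → ι → ℝ) (c : ℕ → ℝ) {w : ℕ → ℝ}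
    (hA : ∀ (K : ℕ) (t : ℝ), |t| ≤ l₀ → ∀ τ ∈ T K, 0 ≤ A K t τ)
    (hB : ∀ (K : ℕ) (t : ℝ), |t| ≤ l₀ → ∀ τ ∈ T K, 0 ≤ B K t τ)
    (hw0 : ∀ K, 0 ≤ w K) (hws : Summable w)
    (hmA : ∀ (K : ℕ) (t : ℝ), |t| ≤ l₀ → ∑ τ ∈ T K, max 0 (A K t τ - Real.exp (-c K) * B K t τ) ≤ w K * ∑ τ ∈ T K, A K t τ)
    (hmB : ∀ (K : ℕ) (t : ℝ), |t| ≤ l₀ → ∑ τ ∈ T K, max 0 (B K t τ - Real.exp (c K) * A K t τ) ≤ w K * ∑ τ ∈ T K, B K t τ) :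
    ShellWeightBound l₀ T A B (fun K t τ => max 0 (A K t τ - Real.exp (-c K) * B K t τ))
      (fun K t τ => max 0 (B K t τ - Real.exp (c K) * A K t τ)) w where
  nonneg := hw0
  summable := hws
  sh_nonneg_left _ _ _ _ _ := le_max_left _ _
  sh_le_left K t ht τ hτ := posPart_sub_exp_mul_le (-c K) (hA K t ht τ hτ) (hB K t ht τ hτ)
  sh_nonneg_right _ _ _ _ _ := le_max_left _ _
  sh_le_right K t ht τ hτ := posPart_sub_exp_mul_le (c K) (hB K t ht τ hτ) (hA K t ht τ hτ)
  left := hmA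
  right := hmB

/-- **★ THE HYBRID WITH ZERO CORE RADIUS FROM ℓ¹ MATCHING.**  NE7b's `RelWeightBound … W` (N20), non-negative weights, summable one-sided ℓ¹ mismatch fractions `w` at
constants `c` with `W + w < 1` ⇒ `HybridNE7 l₀ vol T A B Bad W shA⋆ shB⋆ w 0` — the tree's `NE7.hybridNE7_of_core` BY NAME on §1's two faces; node U5's exit
`NE7.target_of_hybridNE7` then gives `NE7.Target vol l₀ (hybridDelta vol 0 (W + w)) Z` from the dictionary.  (ℓ¹ class-matching ⇒ U5's total matching; the converse fails —
classes may redistribute.) [cite: King1986, (3.10)–(3.13) pp.656–657 (template only)] [folklore] -/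
theorem hybridNE7_optShell_of_l1Mismatch (A B : ℕ → ℝ → ι → ℝ) (c : ℕ → ℝ) {W w : ℕ → ℝ}
    (hW : RelWeightBound l₀ T A B Bad W)
    (hA : ∀ (K : ℕ) (t : ℝ), |t| ≤ l₀ → ∀ τ ∈ T K, 0 ≤ A K t τ)
    (hB : ∀ (K : ℕ) (t : ℝ), |t| ≤ l₀ → ∀ τ ∈ T K, 0 ≤ B K t τ)
    (hw0 : ∀ K, 0 ≤ w K) (hws : Summable w)
    (hmA : ∀ (K : ℕ) (t : ℝ), |t| ≤ l₀ → ∑ τ ∈ T K, max 0 (A K t τ - Real.exp (-c K) * B K t τ) ≤ w K * ∑ τ ∈ T K, A K t τ)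
    (hmB : ∀ (K : ℕ) (t : ℝ), |t| ≤ l₀ → ∑ τ ∈ T K, max 0 (B K t τ - Real.exp (c K) * A K t τ) ≤ w K * ∑ τ ∈ T K, B K t τ)
    (hlt : ∀ K, W K + w K < 1) :
    HybridNE7 l₀ vol T A B Bad W (fun K t τ => max 0 (A K t τ - Real.exp (-c K) * B K t τ))
      (fun K t τ => max 0 (B K t τ - Real.exp (c K) * A K t τ)) w (fun _ => 0) :=
  NE7.hybridNE7_of_core hW (shellWeightBound_optShell A B c hA hB hw0 hws hmA hmB) hlt summable_zero
    (core_optShell_zero A B c (fun K t ht τ hτ => hA K t ht τ (Finset.mem_sdiff.mp hτ).1)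
      (fun K t ht τ hτ => hB K t ht τ (Finset.mem_sdiff.mp hτ).1))

/-- … and node U5's DECL target from it (`NE7.target_of_hybridNE7` BY NAME; dictionary E1∕E2 and positivity displayed): ℓ¹ class-matching modulo constants with summable
fraction ⇒ `Spine.NE7.Target vol l₀ (hybridDelta vol 0 (W + w)) Z`. [folklore] -/
theorem target_optShell_of_l1Mismatch (A B : ℕ → ℝ → ι → ℝ) (c : ℕ → ℝ) {W w : ℕ → ℝ} {Z : ℕ → ℝ → ℝ}
    (hvol : 0 < vol) (hl₀ : 0 ≤ l₀) (hW : RelWeightBound l₀ T A B Bad W)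
    (hA : ∀ (K : ℕ) (t : ℝ), |t| ≤ l₀ → ∀ τ ∈ T K, 0 ≤ A K t τ)
    (hB : ∀ (K : ℕ) (t : ℝ), |t| ≤ l₀ → ∀ τ ∈ T K, 0 ≤ B K t τ)
    (hw0 : ∀ K, 0 ≤ w K) (hws : Summable w)
    (hmA : ∀ (K : ℕ) (t : ℝ), |t| ≤ l₀ → ∑ τ ∈ T K, max 0 (A K t τ - Real.exp (-c K) * B K t τ) ≤ w K * ∑ τ ∈ T K, A K t τ)
    (hmB : ∀ (K : ℕ) (t : ℝ), |t| ≤ l₀ → ∑ τ ∈ T K, max 0 (B K t τ - Real.exp (c K) * A K t τ) ≤ w K * ∑ τ ∈ T K, B K t τ)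
    (hlt : ∀ K, W K + w K < 1)
    (hZA : ∀ (K : ℕ) (t : ℝ), |t| ≤ l₀ → Z K t = ∑ τ ∈ T K, A K t τ) (hZB : ∀ (K : ℕ) (t : ℝ), |t| ≤ l₀ → Z (K + 1) t = ∑ τ ∈ T K, B K t τ)
    (hpos : ∀ (K : ℕ) (t : ℝ), |t| ≤ l₀ → 0 < ∑ τ ∈ T K, A K t τ) :
    NE7.Target vol l₀ (hybridDelta vol (fun _ => 0) fun K => W K + w K) Z :=
  NE7.target_of_hybridNE7 (hybridNE7_optShell_of_l1Mismatch A B c hW hA hB hw0 hws hmA hmB hlt) hvol hl₀ hZA hZB hpos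

end Abstract

/-! ## §2 At dag-n20-d's spine reading of record `crOfRecord₁₃VAt K₀ jcut sh⋆` (physical volume letter; every offset, every cut policy) -/

section Record

variable {F : T4Family} {N : ℕ} [NeZero N]

/-- **THE ℓ¹-OPTIMAL SHELL SPLIT EXISTS AS A `ShellSplit₁₃CoPH`** (the type is an arbitrary pair of shell readings per tuple): for every constant reading `cK` there is `sh⋆` with
`sh⋆ F θ hP g₀ os = ((weightA₁₃ − e^{−c}·weightB₁₃)⁺, (weightB₁₃ − e^{c}·weightA₁₃)⁺)` at `c := cK F θ hP g₀ os`.  (∃-form, so that no `def` is introduced.) [bookkeeping] -/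
theorem exists_optShellSplit (K₀ : ℕ)
    (cK : (F : T4Family) → (θ : Stage13HParams F N) → θ.Provisos₁₃CoPH F N → (ℕ → ℝ) → List (ULoop F) → ℕ → ℝ) :
    ∃ sh : ShellSplit₁₃CoPH N K₀, ∀ (F : T4Family) (θ : Stage13HParams F N) (hP : θ.Provisos₁₃CoPH F N) (g₀ : ℕ → ℝ) (os : List (ULoop F)),
      sh F θ hP g₀ os =
        (fun K t x => max 0 (weightA₁₃ θ hP K₀ g₀ os K t x - Real.exp (-cK F θ hP g₀ os K) * weightB₁₃ θ hP K₀ g₀ os K t x),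
         fun K t x => max 0 (weightB₁₃ θ hP K₀ g₀ os K t x - Real.exp (cK F θ hP g₀ os K) * weightA₁₃ θ hP K₀ g₀ os K t x)) :=
  ⟨fun F θ hP g₀ os =>
    (fun K t x => max 0 (weightA₁₃ θ hP K₀ g₀ os K t x - Real.exp (-cK F θ hP g₀ os K) * weightB₁₃ θ hP K₀ g₀ os K t x),
     fun K t x => max 0 (weightB₁₃ θ hP K₀ g₀ os K t x - Real.exp (cK F θ hP g₀ os K) * weightA₁₃ θ hP K₀ g₀ os K t x)),
    fun _ _ _ _ _ => rfl⟩

variable (K₀ : ℕ) (jcut : ℕ → ℕ) (sh : ShellSplit₁₃CoPH N K₀) (θ : Stage13HParams F N) (hP : θ.Provisos₁₃CoPH F N) (g₀ : ℕ → ℝ) (os : List (ULoop F))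
  (c : ℕ → ℝ)

/-- **★★★ N19′'s PAIR AT THE READING OF RECORD WITH THE ℓ¹-OPTIMAL SHELLS HOLDS OUTRIGHT** — `NE7.Core` at the reading's own canonical rate `(cr).δ` AND `Summable (cr).δ`, at
`crOfRecord₁₃VAt K₀ jcut sh⋆`, for EVERY offset `K₀`, EVERY cut policy `jcut`, EVERY Stage-13 tuple with core provisos, EVERY `g₀`, `os`, EVERY constants `c` (dag-n20-d's
`core_crOfRecord₁₃VAt` on §1's `core_optShell_zero`; `0 ≤` weights by dag-n20-w2's `weightA₁₃_nonneg ∕ weightB₁₃_nonneg`).  No rate, no flow, no window enters: at this end of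
the shell dial the N19′ conjunct carries NO content. [cite: King1986, (3.10)–(3.13) pp.656–657 (template only)] [bookkeeping] -/
theorem core_crOfRecord₁₃VAt_optShell
    (hsh : sh F θ hP g₀ os =
      (fun K t x => max 0 (weightA₁₃ θ hP K₀ g₀ os K t x - Real.exp (-c K) * weightB₁₃ θ hP K₀ g₀ os K t x),
       fun K t x => max 0 (weightB₁₃ θ hP K₀ g₀ os K t x - Real.exp (c K) * weightA₁₃ θ hP K₀ g₀ os K t x))) :
    (letI := (crOfRecord₁₃VAt K₀ jcut sh F θ hP g₀ os).dec
     NE7.Core (crOfRecord₁₃VAt K₀ jcut sh F θ hP g₀ os).l₀ (crOfRecord₁₃VAt K₀ jcut sh F θ hP g₀ os).vol (crOfRecord₁₃VAt K₀ jcut sh F θ hP g₀ os).T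
      (crOfRecord₁₃VAt K₀ jcut sh F θ hP g₀ os).Bad
      (fun K t τ => (crOfRecord₁₃VAt K₀ jcut sh F θ hP g₀ os).A K t τ - (crOfRecord₁₃VAt K₀ jcut sh F θ hP g₀ os).shA K t τ)
      (fun K t τ => (crOfRecord₁₃VAt K₀ jcut sh F θ hP g₀ os).B K t τ - (crOfRecord₁₃VAt K₀ jcut sh F θ hP g₀ os).shB K t τ)
      (crOfRecord₁₃VAt K₀ jcut sh F θ hP g₀ os).δ) ∧ Summable (crOfRecord₁₃VAt K₀ jcut sh F θ hP g₀ os).δ := by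
  letI : DecidableEq (Σ K, SiteSeqKey F (K₀ + K)) := Classical.decEq _
  have hA := weightA₁₃_nonneg F θ hP K₀ g₀ os
  have hB := weightB₁₃_nonneg F θ hP K₀ g₀ os
  refine core_crOfRecord₁₃VAt K₀ jcut sh θ hP g₀ os (δ := fun _ => 0) ?_ ?_ summable_zero
  · intro K t _ x _
    rw [hsh]
    exact sub_nonneg.mpr (posPart_sub_exp_mul_le (-c K) (hA K t x) (hB K t x))
  · rw [hsh]
    exact core_optShell_zero (l₀ := 1) (vol := (F.side : ℝ) ^ 4) (T := classSet₁₃ θ K₀ g₀) (Bad := badClass₁₃ θ K₀ g₀ jcut)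
      (weightA₁₃ θ hP K₀ g₀ os) (weightB₁₃ θ hP K₀ g₀ os) c (fun K t _ x _ => hA K t x) (fun K t _ x _ => hB K t x)

/-- **★★ N21's FACE AT THE SAME READING FROM THE ℓ¹ MISMATCH FRACTIONS**: if at every `K` and `|t| ≤ 1` the one-sided ℓ¹ mismatch sums of the record's keyed class weights,
`Σ_{classSet₁₃} (weightA₁₃ − e^{−c_K} weightB₁₃)⁺ ≤ w K · Σ weightA₁₃` and `Σ_{classSet₁₃} (weightB₁₃ − e^{c_K} weightA₁₃)⁺ ≤ w K · Σ weightB₁₃`, with `0 ≤ w` summable, then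
`ShellWeightBound` holds at `crOfRecord₁₃VAt K₀ jcut sh⋆` with the reading's canonical `Wsh` (dag-n20-d's `shellWeightBound_crOfRecord₁₃VAt` on §1's `shellWeightBound_optShell`).
The hypothesis IS the two-run matching content — NOT PRINTED for `d = 4`, NOT proved. [cite: Balaban1989LargeFieldII, Thm 1 + (0.1) pp.355–356 (one-run template only)] [bookkeeping] -/
theorem shellWeightBound_crOfRecord₁₃VAt_optShell_of_l1Mismatch {w : ℕ → ℝ}
    (hsh : sh F θ hP g₀ os =
      (fun K t x => max 0 (weightA₁₃ θ hP K₀ g₀ os K t x - Real.exp (-c K) * weightB₁₃ θ hP K₀ g₀ os K t x),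
       fun K t x => max 0 (weightB₁₃ θ hP K₀ g₀ os K t x - Real.exp (c K) * weightA₁₃ θ hP K₀ g₀ os K t x)))
    (hw0 : ∀ K, 0 ≤ w K) (hws : Summable w)
    (hmA : ∀ (K : ℕ) (t : ℝ), |t| ≤ 1 →
      ∑ x ∈ classSet₁₃ θ K₀ g₀ K, max 0 (weightA₁₃ θ hP K₀ g₀ os K t x - Real.exp (-c K) * weightB₁₃ θ hP K₀ g₀ os K t x)
        ≤ w K * ∑ x ∈ classSet₁₃ θ K₀ g₀ K, weightA₁₃ θ hP K₀ g₀ os K t x)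
    (hmB : ∀ (K : ℕ) (t : ℝ), |t| ≤ 1 →
      ∑ x ∈ classSet₁₃ θ K₀ g₀ K, max 0 (weightB₁₃ θ hP K₀ g₀ os K t x - Real.exp (c K) * weightA₁₃ θ hP K₀ g₀ os K t x)
        ≤ w K * ∑ x ∈ classSet₁₃ θ K₀ g₀ K, weightB₁₃ θ hP K₀ g₀ os K t x) :
    ShellWeightBound (crOfRecord₁₃VAt K₀ jcut sh F θ hP g₀ os).l₀ (crOfRecord₁₃VAt K₀ jcut sh F θ hP g₀ os).T (crOfRecord₁₃VAt K₀ jcut sh F θ hP g₀ os).A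
      (crOfRecord₁₃VAt K₀ jcut sh F θ hP g₀ os).B (crOfRecord₁₃VAt K₀ jcut sh F θ hP g₀ os).shA (crOfRecord₁₃VAt K₀ jcut sh F θ hP g₀ os).shB
      (crOfRecord₁₃VAt K₀ jcut sh F θ hP g₀ os).Wsh := by
  letI : DecidableEq (Σ K, SiteSeqKey F (K₀ + K)) := Classical.decEq _
  have hA := weightA₁₃_nonneg F θ hP K₀ g₀ os
  have hB := weightB₁₃_nonneg F θ hP K₀ g₀ os
  refine shellWeightBound_crOfRecord₁₃VAt K₀ jcut sh θ hP g₀ os (Wsh := w) ?_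
  rw [hsh]
  exact shellWeightBound_optShell (l₀ := 1) (T := classSet₁₃ θ K₀ g₀) (weightA₁₃ θ hP K₀ g₀ os) (weightB₁₃ θ hP K₀ g₀ os) c
    (fun K t _ x _ => hA K t x) (fun K t _ x _ => hB K t x) hw0 hws hmA hmB

/-- **N20's FACE AT THE SAME READING WITH THE ZERO CUT** (dag-n20-w2's `relWeightBound_carriers₁₃_cutZero` p590852 through dag-n20-d's `relWeightBound_crOfRecord₁₃VAt`): free for
every shell split, in particular `sh⋆`. [bookkeeping] -/
theorem relWeightBound_crOfRecord₁₃VAt_cutZero :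
    RelWeightBound (crOfRecord₁₃VAt K₀ (fun _ => 0) sh F θ hP g₀ os).l₀ (crOfRecord₁₃VAt K₀ (fun _ => 0) sh F θ hP g₀ os).T
      (crOfRecord₁₃VAt K₀ (fun _ => 0) sh F θ hP g₀ os).A (crOfRecord₁₃VAt K₀ (fun _ => 0) sh F θ hP g₀ os).B
      (crOfRecord₁₃VAt K₀ (fun _ => 0) sh F θ hP g₀ os).Bad (crOfRecord₁₃VAt K₀ (fun _ => 0) sh F θ hP g₀ os).W :=
  relWeightBound_crOfRecord₁₃VAt K₀ (fun _ => 0) sh θ hP g₀ os (relWeightBound_carriers₁₃_cutZero F θ hP K₀ g₀ os)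

end Record

end Summit.QuantumFields.YangMills.BalabanUVNodes.N20CoreEdgeShellDial

end
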